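import Literature.MathematicalPhysics.QuantumLattice.LayeredLatticeEnergyTransport
import Literature.MathematicalPhysics.QuantumLattice.SublatticeSelectiveInteractions
import HarnessLib

/-!
# Periodically stacked layered crystals (bilayer / trilayer / staged cuprates): the certified one-band
# window of `ℤ^d` is a window for every `z`-periodic stacking, `[e_ρ − (2/(p+1))Σ_{j,b}|tz_{jb}|, e_ρ]`

Topic `Literature/MathematicalPhysics/QuantumLattice` (namespace = path; family `hubbard`). Sequel of
`LayeredLatticeEnergyTransport.lean` (uniform stacking; the stacked state `⊗_k ω₀` and its energies) inside the
superlattice calculus of `SuperlatticeCellEnergyFamilies.lean` / `SublatticeSelectiveInteractions.lean` (views,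
cell energies, periodic classes, sublattice-selective hopping patterns). The record-`T_c` cuprates are BILAYER and
TRILAYER crystals: the interlayer couplings alternate along the stacking axis (intra- and inter-multilayer), so the
one-band crystal Hamiltonian is PERIODIC, not translation invariant, in the layer direction. This file words them:
for stacking period `p + 1`, in-plane one-band model (`U`, hoppings `θ_a` along `u_a`) and interlayer bonds along
`w_b` with amplitude `tz j b` when they start in a layer of class `j (mod p+1)`,

  `e_ρ(one-band, ℤ^d) − (2/(p+1)) Σ_{j,b} |tz j b| ≤ inf_{periodic states, cell filling ρ} e(crystal) ≤ e_ρ(one-band, ℤ^d)`.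

CAP: the stack of every translation-invariant state of `ℤ^d` of density `ρ` is a translation-invariant (hence
periodic) trial state of cell filling `ρ` that sees no interlayer pattern. FLOOR: the CELL AVERAGE of a periodic
state is translation invariant with density = cell filling, so its in-plane energy obeys the layer-marginal floor
of the sequel's parent; each interlayer pattern costs at most `2|t|/|cell|` (SHARP class constant: exactly one cell
point starts, and one ends, a kept bond through the origin).

## Contents

* §1 `stackPeriods d p` (period `p+1` along coordinate `0`), `layerCoset d j`, `inPlaneModel` (layered model without
  interlayer vectors), **`periodicLayeredViews p U u θ w tz`** (a `viewFamily` over constant in-plane views with the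
  patterns `sublatticeVectorHoppingViews (stackPeriods d p) (layerCoset d j) (w b) 1` as directions).
* §2 the stack sees no pattern: `stack_expect_vectorHopping_pair_eq_zero`,
  `meanEnergy_stack_sublatticeVectorHopping_eq_zero`, `cellEnergy_stack_sublatticeVectorHoppingViews_eq_zero`,
  **`cellEnergy_stack_periodicLayeredViews`** (`= e(ω₀)`).
* §2b the sharp class constant: `card_filter_inCoset_cellPos_sub_le_one` (at most one cell point per coset),
  `abs_meanEnergy_sublatticeVectorHopping_le_ite`, **`abs_cellEnergy_sublatticeVectorHoppingViews_le_div`**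
  (`|e| ≤ 2|t|/|cell|`, improving the class constant `2|t|` of `SublatticeSelectiveInteractions`), `card_cell_stackPeriods`.
* §3 transport: `infCellEnergyOn_periodicLayeredViews_le` (cap),
  `IsPeriodic.tiGroundEnergyDensityAt_sub_le_cellEnergy_periodicLayeredViews` (floor for every periodic state),
  `tiGroundEnergyDensityAt_sub_le_infCellEnergyOn_periodicLayeredViews`, **`infCellEnergyOn_periodicLayeredViews_mem_Icc`**.
* §4 `t–t'` instances: `periodicLayeredHubbardTTPrimeViews`,
  **`infCellEnergyOn_periodicLayeredHubbardTTPrime_mem_Icc`** (vs `energyDensityTT'`, `U ≥ 0`, `0 < ρ < 2`), and the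
  bilayer crystal `infCellEnergyOn_bilayerHubbardTTPrime_mem_Icc`: `[energyDensityTT' − (|t⊥| + |t⊥'|), energyDensityTT']`.

Everything is PROVED; definitions with bodies: `stackPeriods`, `layerCoset`, `inPlaneModel`, `periodicLayeredViews`,
`periodicLayeredHubbardTTPrimeViews`; no named fact, no number. HONEST SCOPE: equivalent planes (the same one-band
parameters and, for the floor's comparison state, the same mean filling in every layer); inequivalent planes (inner
vs outer planes of a trilayer with different fillings) need `k`-dependent factors and a density split — not here;
energies only (no order parameter, no `T > 0`, no phase word).

## Tree / Mathlib search

REUSED: `stack`, `stack_isTranslationInvariant`, `density_stack`, `meanEnergy_stack_layeredModel`,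
`stack_expect_creation_mul_annihilation_eq_zero`, `layeredModel`, `vectorHoppingModel`,
`IsTranslationInvariant.tiGroundEnergyDensityAt_sub_le_meanEnergy_layeredModel`, `ttPrimeVec`/`ttPrimeAmp`,
`hubbardTTPrimeFermionInteraction_eq_vectorHoppingModel` (`LayeredLatticeEnergyTransport`); `viewFamily`,
`cellEnergy_viewFamily`, `IsTranslationInvariant.cellEnergy_const`, `cellEnergy_const`, `infCellEnergyOn` (+ `le_`/`_le_cellEnergy`),
`periodicStatesAt`, `IsTranslationInvariant.isPeriodic`, `IsTranslationInvariant.cellFilling_eq`,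
`IsPeriodic.isTranslationInvariant_cellAverage`, `cellFilling_eq_density_cellAverage` (`SuperlatticeCellEnergyFamilies`,
`PeriodicStatesCellAverage`); `sublatticeVectorHopping` (+ `_apply_pair(_of_inCoset/_of_not_inCoset)`, `_meanEnergyObs`),
`sublatticeVectorHoppingViews`, `InCoset`, `inCoset_sub_iff`, `inCoset_sub_zero_iff`, `cellPos`, `Cell`
(`SublatticeSelectiveInteractions`); `norm_fermionEmbed_vectorHopping_pair_le_two_mul` (`LatticeVectorHoppingInteraction`);
`norm_expect_le` (`InfVolFermionStateBounds`); Mathlib `Int.eq_zero_of_abs_lt_dvd`, `Finset.card_le_one`, `Finset.sum_boole`.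

## References

* H. Araki, H. Moriya, Rev. Math. Phys. 15 (2003) 93, §11.1 Theorem 11.2 (product states), §4.1 (periodic
  structure, cosets). [cite: ArakiMoriya2003, §11.1 Theorem 11.2]
* O. Bratteli, A. Kishimoto, D. W. Robinson, CMP 64 (1978) 41, Thm. 2 (variational principle). [cite: BratteliKishimotoRobinson1978, Thm. 2]
* O. Bratteli, D. W. Robinson, *OAQSM 1* (1987), Prop. 2.3.11 (states are contractive). [cite: BratteliRobinsonI1987, Prop. 2.3.11]
* E. Pavarini et al., PRL 87 (2001) 047003, eq. (1) (one-band models of layered cuprates). [cite: PavariniEtAl2001, eq. (1)]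
-/

noncomputable section

namespace Literature.MathematicalPhysics.QuantumLattice

open Matrix Finset HubbardWave0 Literature.Probability.LatticeModels ThermodynamicLimit
open scoped ComplexOrder BigOperators

variable {d : ℕ} {ι κ : Type*} [Fintype ι] [Fintype κ]

/-! ### §1. Stacking periods and layer cosets -/

/-- **The stacking superlattice**: period `p + 1` in the layer direction (coordinate `0`), period `1` in-plane.
[cite: ArakiMoriya2003, §4.1] -/
def stackPeriods (d p : ℕ) : Fin (d + 1) → ℕ := fun i => if i = 0 then p else 0

/-- **The coset representative of the layer class `j`**: the site `(j, 0, …, 0)`. [cite: ArakiMoriya2003, §4.1] -/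
def layerCoset (d : ℕ) (j : ℤ) : Site (d + 1) := Fin.cons j 0

/-- **The in-plane part of a layered crystal** (a copy of the one-band model in every layer, no interlayer
bond): the layered model with an empty set of interlayer vectors. [cite: PavariniEtAl2001, eq. (1)] -/
def inPlaneModel (U : ℝ) (u : ι → Site d) (θ : ι → ℝ) : FermionInteraction (d + 1) :=
  layeredModel U u θ (fun b : Fin 0 => b.elim0) (fun b : Fin 0 => b.elim0)

/-- **The views of a PERIODICALLY STACKED layered crystal**: in every layer the one-band model (`U`, hoppings
`θ_a` along `u_a`); interlayer bonds along `w_b` starting in a layer of class `j (mod p+1)` carry the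
amplitude `tz j b` (bilayer crystals `p + 1 = 2`: intra- and inter-bilayer couplings; trilayers; staged stackings).
A `viewFamily` over the constant in-plane views with the sublattice-selective hopping patterns as directions.
[cite: PavariniEtAl2001, eq. (1)] -/
def periodicLayeredViews (p : ℕ) (U : ℝ) (u : ι → Site d) (θ : ι → ℝ) (w : κ → Site (d + 1))
    (tz : Fin (p + 1) → κ → ℝ) : Cell (stackPeriods d p) → FermionInteraction (d + 1) :=
  viewFamily (fun _ => inPlaneModel U u θ)
    (fun jb : Fin (p + 1) × κ => sublatticeVectorHoppingViews (stackPeriods d p) (layerCoset d jb.1) (w jb.2) 1)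
    fun jb => tz jb.1 jb.2

/-! ### §2. The stack sees no interlayer pattern -/

namespace InfVolFermionState

/-- **A bond term between different layers has zero expectation in the stack.** [cite: ArakiMoriya2003, §11.1 Theorem 11.2] -/
theorem stack_expect_vectorHopping_pair_eq_zero (ω₀ : InfVolFermionState d) (h : ω₀.IsEven) {w : Site (d + 1)}
    (hw : w 0 ≠ 0) (t : ℝ) (x : Site (d + 1)) :
    (ω₀.stack h).expect {x, x + w} ((vectorHoppingFermionInteraction (d + 1) w t).Φ {x, x + w}) = 0 := by
  have hw0 : w ≠ 0 := fun h0 => hw (by rw [h0]; rfl)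
  rw [vectorHoppingFermionInteraction_apply_pair hw0, map_smul, map_sum]
  refine smul_eq_zero_of_right _ (Finset.sum_eq_zero fun σ _ => ?_)
  rw [map_add, stack_expect_creation_mul_annihilation_eq_zero ω₀ h _ _ (apply_zero_ne_of_add hw),
    stack_expect_creation_mul_annihilation_eq_zero ω₀ h _ _ (apply_zero_ne_of_add hw).symm, add_zero]

/-- **Sublattice-selective interlayer bonds have zero mean energy in the stack** (each view: the full bond or
nothing, and full interlayer bonds vanish). [cite: ArakiMoriya2003, §11.1 Theorem 11.2] -/
theorem meanEnergy_stack_sublatticeVectorHopping_eq_zero (ω₀ : InfVolFermionState d) (h : ω₀.IsEven)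
    (q : Fin (d + 1) → ℕ) (c : Site (d + 1)) {w : Site (d + 1)} (hw : w 0 ≠ 0) (t : ℝ) {R : ℝ}
    (hwR : w ∈ thicken ({0} : Finset (Site (d + 1))) R) :
    (ω₀.stack h).meanEnergy (sublatticeVectorHopping q c w t) R = 0 := by
  have hw0 : w ≠ 0 := fun h0 => hw (by rw [h0]; rfl)
  have hpair : ∀ x : Site (d + 1),
      (ω₀.stack h).expect {x, x + w} ((sublatticeVectorHopping q c w t).Φ {x, x + w}) = 0 := by
    intro x
    rw [sublatticeVectorHopping_apply_pair q c hw0 t x]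
    split_ifs
    · exact stack_expect_vectorHopping_pair_eq_zero ω₀ h hw t x
    · exact map_zero _
  rw [InfVolFermionState.meanEnergy, sublatticeVectorHopping_meanEnergyObs q c hw0 t hwR, map_add, map_smul, map_smul,
    (ω₀.stack h).compatible, (ω₀.stack h).compatible, hpair]
  have h2 := hpair (-w)
  rw [show -w + w = (0 : Site (d + 1)) from neg_add_cancel w] at h2 ⊢
  rw [h2, smul_zero, add_zero, Complex.zero_re]

/-- **The stack's cell energy of every interlayer pattern vanishes.** [cite: ArakiMoriya2003, §11.1 Theorem 11.2] -/
theorem cellEnergy_stack_sublatticeVectorHoppingViews_eq_zero {ω₀ : InfVolFermionState d}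
    (hω₀ : ω₀.IsTranslationInvariant) (h : ω₀.IsEven) (q : Fin (d + 1) → ℕ) (c : Site (d + 1)) {w : Site (d + 1)}
    (hw : w 0 ≠ 0) (t : ℝ) {R : ℝ} (hwR : w ∈ thicken ({0} : Finset (Site (d + 1))) R) :
    (ω₀.stack h).cellEnergy (sublatticeVectorHoppingViews q c w t) R = 0 := by
  rw [InfVolFermionState.cellEnergy]
  refine mul_eq_zero_of_right _ (Finset.sum_eq_zero fun n _ => ?_)
  rw [stack_isTranslationInvariant hω₀ h (cellPos n), sublatticeVectorHoppingViews]
  exact meanEnergy_stack_sublatticeVectorHopping_eq_zero ω₀ h q _ hw t hwR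

/-- **The stack's cell energy of the periodically stacked crystal is the one-band mean energy of `ω₀`.**
[cite: ArakiMoriya2003, §11.1 Theorem 11.2] -/
theorem cellEnergy_stack_periodicLayeredViews {ω₀ : InfVolFermionState d} (hω₀ : ω₀.IsTranslationInvariant)
    (h : ω₀.IsEven) (p : ℕ) (U : ℝ) {u : ι → Site d} (hu : ∀ a, u a ≠ 0) (θ : ι → ℝ) {w : κ → Site (d + 1)}
    (hw : ∀ b, w b 0 ≠ 0) (tz : Fin (p + 1) → κ → ℝ) {R R' : ℝ} (hR : 1 ≤ R) (hRR' : R ≤ R')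
    (huR : ∀ a, u a ∈ thicken ({0} : Finset (Site d)) R) (hwR' : ∀ b, w b ∈ thicken ({0} : Finset (Site (d + 1))) R') :
    (ω₀.stack h).cellEnergy (periodicLayeredViews p U u θ w tz) R' = ω₀.meanEnergy (vectorHoppingModel U u θ) R := by
  rw [periodicLayeredViews, InfVolFermionState.cellEnergy_viewFamily,
    (stack_isTranslationInvariant hω₀ h).cellEnergy_const, inPlaneModel,
    meanEnergy_stack_layeredModel hω₀ h U hu θ (fun b : Fin 0 => b.elim0) _ hR hRR' huR (fun b : Fin 0 => b.elim0)]
  simp only [cellEnergy_stack_sublatticeVectorHoppingViews_eq_zero hω₀ h _ _ (hw _) 1 (hwR' _), mul_zero,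
    Finset.sum_const_zero, add_zero]

end InfVolFermionState

/-! ### §2b. The sharp class constant of a sublattice-selective hopping pattern: `2|t| / |cell|` -/

section SharpConstant

variable {q : Fin (d + 1) → ℕ}

omit [Fintype ι] [Fintype κ] in
/-- At most one point of the fundamental cell lies in a given coset (shifted by any vector): two cell points
congruent modulo the periods coincide. [cite: ArakiMoriya2003, §4.1] -/
theorem card_filter_inCoset_cellPos_sub_le_one {d' : ℕ} (q' : Fin d' → ℕ) (c v : Site d') :
    (Finset.univ.filter fun n : Cell q' => InCoset q' c (cellPos n - v)).card ≤ 1 := by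
  refine Finset.card_le_one.2 fun n hn m hm => ?_
  rw [Finset.mem_filter] at hn hm
  funext i
  have h1 : ((q' i : ℤ) + 1) ∣ (cellPos n - v) i - c i := Int.dvd_of_emod_eq_zero (hn.2 i)
  have h2 : ((q' i : ℤ) + 1) ∣ (cellPos m - v) i - c i := Int.dvd_of_emod_eq_zero (hm.2 i)
  have h3 : ((q' i : ℤ) + 1) ∣ ((n i : ℕ) : ℤ) - ((m i : ℕ) : ℤ) := by
    have key : ((n i : ℕ) : ℤ) - ((m i : ℕ) : ℤ) = ((cellPos n - v) i - c i) - ((cellPos m - v) i - c i) := by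
      simp only [Pi.sub_apply, cellPos]; ring
    rw [key]
    exact dvd_sub h1 h2
  have hn' : ((n i : ℕ) : ℤ) ≤ q' i := by exact_mod_cast Nat.lt_succ_iff.1 (n i).isLt
  have hm' : ((m i : ℕ) : ℤ) ≤ q' i := by exact_mod_cast Nat.lt_succ_iff.1 (m i).isLt
  have h0 : ((n i : ℕ) : ℤ) - ((m i : ℕ) : ℤ) = 0 :=
    Int.eq_zero_of_abs_lt_dvd h3 (abs_sub_lt_iff.2 ⟨by linarith [Int.natCast_nonneg (m i : ℕ)], by linarith [Int.natCast_nonneg (n i : ℕ)]⟩)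
  exact Fin.ext (by exact_mod_cast sub_eq_zero.1 h0)

open scoped Matrix.Norms.L2Operator in
omit [Fintype ι] [Fintype κ] in
/-- An embedded sublattice-selective bond term has norm `≤ 2|t|` if its start lies in the coset and is `0`
otherwise. [cite: BratteliRobinsonI1987, Prop. 2.3.11] -/
theorem norm_fermionEmbed_sublatticeVectorHopping_pair_le_ite {d' : ℕ} (q' : Fin d' → ℕ) (c : Site d') {v : Site d'}
    (hv : v ≠ 0) (t : ℝ) {Λ' : Finset (Site d')} (x : Site d') (h : ({x, x + v} : Finset (Site d')) ⊆ Λ') :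
    ‖fermionEmbed (PolySite.incl h) ((sublatticeVectorHopping q' c v t).Φ {x, x + v})‖ ≤
      if InCoset q' c x then 2 * |t| else 0 := by
  split_ifs with hx
  · rw [sublatticeVectorHopping_apply_pair_of_inCoset q' c hv t hx]
    exact norm_fermionEmbed_vectorHopping_pair_le_two_mul hv t x h
  · rw [sublatticeVectorHopping_apply_pair_of_not_inCoset q' c hv t hx, map_zero, norm_zero]

open scoped Matrix.Norms.L2Operator in
omit [Fintype ι] [Fintype κ] in
/-- **One view's mean energy**: `|e_{Φ_{c,v}}(ω)| ≤ |t|([0 ∈ coset c] + [−v ∈ coset c])` (half a bond for each of the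
two `v`-bonds through the origin that the pattern keeps). [cite: BratteliRobinsonI1987, Prop. 2.3.11] -/
theorem abs_meanEnergy_sublatticeVectorHopping_le_ite {d' : ℕ} (q' : Fin d' → ℕ) (c : Site d') {v : Site d'}
    (hv : v ≠ 0) (t : ℝ) (ω : InfVolFermionState d') {R : ℝ} (hvR : v ∈ thicken ({0} : Finset (Site d')) R) :
    |ω.meanEnergy (sublatticeVectorHopping q' c v t) R| ≤
      |t| * ((if InCoset q' c 0 then 1 else 0) + if InCoset q' c (-v) then 1 else 0) := by
  rw [InfVolFermionState.meanEnergy, sublatticeVectorHopping_meanEnergyObs q' c hv t hvR, map_add, map_smul, map_smul,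
    Complex.add_re]
  have hhalf : ‖(2 : ℂ)⁻¹‖ = 2⁻¹ := by simp
  have h1 := norm_fermionEmbed_sublatticeVectorHopping_pair_le_ite q' c hv t 0 (pair_subset_thicken_zero hvR)
  have h2 := norm_fermionEmbed_sublatticeVectorHopping_pair_le_ite q' c hv t (-v) (pair_neg_subset_thicken_zero hvR)
  have e1 := ω.norm_expect_le _ (fermionEmbed (PolySite.incl (pair_subset_thicken_zero hvR))
    ((sublatticeVectorHopping q' c v t).Φ {0, 0 + v}))
  have e2 := ω.norm_expect_le _ (fermionEmbed (PolySite.incl (pair_neg_subset_thicken_zero hvR))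
    ((sublatticeVectorHopping q' c v t).Φ {-v, -v + v}))
  have r1 := Complex.abs_re_le_norm ((2 : ℂ)⁻¹ • ω.expect _ (fermionEmbed (PolySite.incl (pair_subset_thicken_zero hvR))
    ((sublatticeVectorHopping q' c v t).Φ {0, 0 + v})))
  have r2 := Complex.abs_re_le_norm ((2 : ℂ)⁻¹ • ω.expect _ (fermionEmbed (PolySite.incl (pair_neg_subset_thicken_zero hvR))
    ((sublatticeVectorHopping q' c v t).Φ {-v, -v + v})))
  rw [norm_smul, hhalf] at r1 r2
  refine (abs_add_le _ _).trans ?_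
  have ht : 0 ≤ |t| := abs_nonneg t
  split_ifs at h1 h2 ⊢ <;> nlinarith [norm_nonneg (ω.expect _ (fermionEmbed (PolySite.incl (pair_subset_thicken_zero hvR))
    ((sublatticeVectorHopping q' c v t).Φ {0, 0 + v}))), norm_nonneg (ω.expect _ (fermionEmbed (PolySite.incl
      (pair_neg_subset_thicken_zero hvR)) ((sublatticeVectorHopping q' c v t).Φ {-v, -v + v})))]

omit [Fintype ι] [Fintype κ] in
/-- **The sharp class constant**: the cell energy of the pattern «bonds `{x, x+v}`, `x ∈ coset(c)`» is bounded by
`2|t| / |cell|` for every state (exactly one cell point starts a kept bond through the origin, exactly one ends one).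
[cite: BratteliRobinsonI1987, Prop. 2.3.11] -/
theorem abs_cellEnergy_sublatticeVectorHoppingViews_le_div {d' : ℕ} (q' : Fin d' → ℕ) (c : Site d') {v : Site d'}
    (hv : v ≠ 0) (t : ℝ) {R : ℝ} (hvR : v ∈ thicken ({0} : Finset (Site d')) R) (ω : InfVolFermionState d') :
    |ω.cellEnergy (sublatticeVectorHoppingViews q' c v t) R| ≤ 2 * |t| / Fintype.card (Cell q') := by
  have hcard : (0 : ℝ) < (Fintype.card (Cell q') : ℝ) := Nat.cast_pos.2 Fintype.card_pos
  rw [InfVolFermionState.cellEnergy, abs_mul, abs_of_pos (inv_pos.2 hcard), le_div_iff₀ hcard, mul_comm, ← mul_assoc,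
    mul_inv_cancel₀ hcard.ne', one_mul]
  refine (Finset.abs_sum_le_sum_abs _ _).trans ?_
  have hview : ∀ n : Cell q', |(ω.shift (cellPos n)).meanEnergy (sublatticeVectorHoppingViews q' c v t n) R| ≤
      |t| * ((if InCoset q' c (cellPos n - 0) then 1 else 0) + if InCoset q' c (cellPos n - v) then 1 else 0) := by
    intro n
    have h := abs_meanEnergy_sublatticeVectorHopping_le_ite q' (c - cellPos n) hv t (ω.shift (cellPos n)) hvR
    refine h.trans (le_of_eq ?_)
    congr 2
    · exact if_congr (by rw [inCoset_sub_zero_iff, sub_zero]) rfl rfl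
    · exact if_congr (by rw [inCoset_sub_iff, neg_add_eq_sub]) rfl rfl
  refine (Finset.sum_le_sum fun n _ => hview n).trans ?_
  rw [← Finset.mul_sum, Finset.sum_add_distrib, Finset.sum_boole, Finset.sum_boole]
  have c1 := card_filter_inCoset_cellPos_sub_le_one q' c 0
  have c2 := card_filter_inCoset_cellPos_sub_le_one q' c v
  have : ((Finset.univ.filter fun n : Cell q' => InCoset q' c (cellPos n - 0)).card : ℝ) +
      ((Finset.univ.filter fun n : Cell q' => InCoset q' c (cellPos n - v)).card : ℝ) ≤ 2 := by
    have h1' : ((Finset.univ.filter fun n : Cell q' => InCoset q' c (cellPos n - 0)).card : ℝ) ≤ 1 := by exact_mod_cast c1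
    have h2' : ((Finset.univ.filter fun n : Cell q' => InCoset q' c (cellPos n - v)).card : ℝ) ≤ 1 := by exact_mod_cast c2
    linarith
  calc |t| * _ ≤ |t| * 2 := mul_le_mul_of_nonneg_left this (abs_nonneg t)
    _ = 2 * |t| := mul_comm _ _

omit [Fintype ι] [Fintype κ] in
/-- The stacking cell has `p + 1` points. [cite: ArakiMoriya2003, §4.1] -/
theorem card_cell_stackPeriods (d p : ℕ) : Fintype.card (Cell (stackPeriods d p)) = p + 1 := by
  rw [Fintype.card_pi, Fin.prod_univ_succ]
  simp [stackPeriods, Fin.succ_ne_zero]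

end SharpConstant

/-! ### §3. Two-sided transport for periodically stacked crystals -/

section Transport

/-- **CAP**: over the periodic states of cell filling `ρ`, the variational cell energy of the periodically
stacked crystal is at most `e_ρ` of the one-band model on `ℤ^d` (trial: the stack of each translation-invariant
state of density `ρ`, a translation-invariant — hence periodic — state of cell filling `ρ`).
[cite: ArakiMoriya2003, §11.1 Theorem 11.2] -/
theorem infCellEnergyOn_periodicLayeredViews_le (hd : 0 < d) {ρ : ℝ}
    (hne : ∃ ω₀ : InfVolFermionState d, ω₀.IsTranslationInvariant ∧ ω₀.density = ρ) (p : ℕ) (U : ℝ)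
    {u : ι → Site d} (hu : ∀ a, u a ≠ 0) (θ : ι → ℝ) {w : κ → Site (d + 1)} (hw : ∀ b, w b 0 ≠ 0)
    (tz : Fin (p + 1) → κ → ℝ) {R R' : ℝ} (hR : 1 ≤ R) (hRR' : R ≤ R')
    (huR : ∀ a, u a ∈ thicken ({0} : Finset (Site d)) R) (hwR' : ∀ b, w b ∈ thicken ({0} : Finset (Site (d + 1))) R') :
    infCellEnergyOn (periodicStatesAt (stackPeriods d p) ρ) (periodicLayeredViews p U u θ w tz) R' ≤
      (vectorHoppingModel U u θ).tiGroundEnergyDensityAt R ρ := by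
  refine (vectorHoppingModel U u θ).le_tiGroundEnergyDensityAt R hne fun ω₀ hω₀ hρ₀ => ?_
  have he := hω₀.isEven hd
  have hTI := InfVolFermionState.stack_isTranslationInvariant hω₀ he
  have hmem : ω₀.stack he ∈ periodicStatesAt (stackPeriods d p) ρ :=
    ⟨hTI.isPeriodic _, by rw [hTI.cellFilling_eq, InfVolFermionState.density_stack, hρ₀]⟩
  rw [← InfVolFermionState.cellEnergy_stack_periodicLayeredViews hω₀ he p U hu θ hw tz hR hRR' huR hwR']
  exact infCellEnergyOn_le_cellEnergy _ R' hmem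

/-- **FLOOR for every periodic state**: its cell energy is at least `e_{ρ̄}` of the one-band model on `ℤ^d`
(the CELL AVERAGE is translation invariant with density the cell filling `ρ̄`; its in-plane energy is bounded
by the layer-marginal argument of `LayeredLatticeEnergyTransport`) minus `(2/(p+1)) Σ_{j,b} |tz j b|` (sharp class
constant `2/|cell|` per pattern).
[cite: BratteliKishimotoRobinson1978, Thm. 2 (condition 2)] -/
theorem InfVolFermionState.IsPeriodic.tiGroundEnergyDensityAt_sub_le_cellEnergy_periodicLayeredViews {p : ℕ}
    {ω : InfVolFermionState (d + 1)} (hω : ω.IsPeriodic (stackPeriods d p)) {ρ : ℝ}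
    (hρ : ω.cellFilling (stackPeriods d p) = ρ) (U : ℝ) {u : ι → Site d} (hu : ∀ a, u a ≠ 0) (θ : ι → ℝ)
    {w : κ → Site (d + 1)} (hw : ∀ b, w b ≠ 0) (tz : Fin (p + 1) → κ → ℝ) {R R' : ℝ} (hR : 1 ≤ R) (hRR' : R ≤ R')
    (huR : ∀ a, u a ∈ thicken ({0} : Finset (Site d)) R) (hwR' : ∀ b, w b ∈ thicken ({0} : Finset (Site (d + 1))) R') :
    (vectorHoppingModel U u θ).tiGroundEnergyDensityAt R ρ - 2 / (p + 1) * ∑ jb : Fin (p + 1) × κ, |tz jb.1 jb.2| ≤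
      ω.cellEnergy (periodicLayeredViews p U u θ w tz) R' := by
  rw [periodicLayeredViews, InfVolFermionState.cellEnergy_viewFamily, ω.cellEnergy_const, inPlaneModel]
  have hTI := hω.isTranslationInvariant_cellAverage
  have hρ' : (ω.cellAverage (stackPeriods d p)).density = ρ := by rw [← ω.cellFilling_eq_density_cellAverage, hρ]
  have h1 := hTI.tiGroundEnergyDensityAt_sub_le_meanEnergy_layeredModel hρ' U hu θ (w := fun b : Fin 0 => b.elim0)
    (fun b => b.elim0) (fun b : Fin 0 => b.elim0) hR hRR' huR (fun b => b.elim0)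
  simp only [Finset.univ_eq_empty, Finset.sum_empty, mul_zero, sub_zero] at h1
  have hp : (0 : ℝ) < p + 1 := by positivity
  have h2 : ∀ jb : Fin (p + 1) × κ, -(2 / (p + 1) * |tz jb.1 jb.2|) ≤
      tz jb.1 jb.2 * ω.cellEnergy (sublatticeVectorHoppingViews (stackPeriods d p) (layerCoset d jb.1) (w jb.2) 1) R' := by
    intro jb
    have hK := abs_cellEnergy_sublatticeVectorHoppingViews_le_div (stackPeriods d p) (layerCoset d jb.1) (hw jb.2) 1 (hwR' jb.2) ω
    rw [abs_one, mul_one, card_cell_stackPeriods, Nat.cast_add, Nat.cast_one] at hK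
    have : |tz jb.1 jb.2 * ω.cellEnergy (sublatticeVectorHoppingViews (stackPeriods d p) (layerCoset d jb.1) (w jb.2) 1) R'| ≤
        2 / (p + 1) * |tz jb.1 jb.2| := by
      rw [abs_mul, mul_comm (2 / ((p : ℝ) + 1))]; exact mul_le_mul_of_nonneg_left hK (abs_nonneg _)
    exact (abs_le.1 this).1
  have h3 : -(∑ jb : Fin (p + 1) × κ, 2 / (p + 1) * |tz jb.1 jb.2|) ≤
      ∑ jb : Fin (p + 1) × κ, tz jb.1 jb.2 *
        ω.cellEnergy (sublatticeVectorHoppingViews (stackPeriods d p) (layerCoset d jb.1) (w jb.2) 1) R' := by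
    rw [← Finset.sum_neg_distrib]; exact Finset.sum_le_sum fun jb _ => h2 jb
  rw [Finset.mul_sum]
  linarith

/-- **FLOOR**: the variational cell energy of the periodically stacked crystal over the periodic states of cell
filling `ρ` is at least `e_ρ(one-band, ℤ^d) − (2/(p+1)) Σ_{j,b} |tz j b|`. [cite: BratteliKishimotoRobinson1978, Thm. 2 (condition 2)] -/
theorem tiGroundEnergyDensityAt_sub_le_infCellEnergyOn_periodicLayeredViews (hd : 0 < d) {ρ : ℝ}
    (hne : ∃ ω₀ : InfVolFermionState d, ω₀.IsTranslationInvariant ∧ ω₀.density = ρ) (p : ℕ) (U : ℝ)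
    {u : ι → Site d} (hu : ∀ a, u a ≠ 0) (θ : ι → ℝ) {w : κ → Site (d + 1)} (hw : ∀ b, w b 0 ≠ 0)
    (tz : Fin (p + 1) → κ → ℝ) {R R' : ℝ} (hR : 1 ≤ R) (hRR' : R ≤ R')
    (huR : ∀ a, u a ∈ thicken ({0} : Finset (Site d)) R) (hwR' : ∀ b, w b ∈ thicken ({0} : Finset (Site (d + 1))) R') :
    (vectorHoppingModel U u θ).tiGroundEnergyDensityAt R ρ - 2 / (p + 1) * ∑ jb : Fin (p + 1) × κ, |tz jb.1 jb.2| ≤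
      infCellEnergyOn (periodicStatesAt (stackPeriods d p) ρ) (periodicLayeredViews p U u θ w tz) R' := by
  obtain ⟨ω₀, hω₀, hρ₀⟩ := hne
  have he := hω₀.isEven hd
  have hTI := InfVolFermionState.stack_isTranslationInvariant hω₀ he
  have hmem : ω₀.stack he ∈ periodicStatesAt (stackPeriods d p) ρ :=
    ⟨hTI.isPeriodic _, by rw [hTI.cellFilling_eq, InfVolFermionState.density_stack, hρ₀]⟩
  have hw0 : ∀ b, w b ≠ 0 := fun b h0 => hw b (by rw [h0]; rfl)
  exact le_infCellEnergyOn _ R' ⟨_, hmem⟩ fun ω hω =>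
    hω.1.tiGroundEnergyDensityAt_sub_le_cellEnergy_periodicLayeredViews hω.2 U hu θ hw0 tz hR hRR' huR hwR'

/-- **THE WINDOW for periodically stacked crystals**:
`inf_{periodic, filling ρ} e(crystal) ∈ [e_ρ(one-band, ℤ^d) − (2/(p+1))Σ_{j,b}|tz j b|, e_ρ(one-band, ℤ^d)]`
(the allowance is `2 × Σ_b` (mean over the layer classes of `|tz j b|`)).
[cite: ArakiMoriya2003, §11.1 Theorem 11.2] -/
theorem infCellEnergyOn_periodicLayeredViews_mem_Icc (hd : 0 < d) {ρ : ℝ}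
    (hne : ∃ ω₀ : InfVolFermionState d, ω₀.IsTranslationInvariant ∧ ω₀.density = ρ) (p : ℕ) (U : ℝ)
    {u : ι → Site d} (hu : ∀ a, u a ≠ 0) (θ : ι → ℝ) {w : κ → Site (d + 1)} (hw : ∀ b, w b 0 ≠ 0)
    (tz : Fin (p + 1) → κ → ℝ) {R R' : ℝ} (hR : 1 ≤ R) (hRR' : R ≤ R')
    (huR : ∀ a, u a ∈ thicken ({0} : Finset (Site d)) R) (hwR' : ∀ b, w b ∈ thicken ({0} : Finset (Site (d + 1))) R') :
    infCellEnergyOn (periodicStatesAt (stackPeriods d p) ρ) (periodicLayeredViews p U u θ w tz) R' ∈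
      Set.Icc ((vectorHoppingModel U u θ).tiGroundEnergyDensityAt R ρ - 2 / (p + 1) * ∑ jb : Fin (p + 1) × κ, |tz jb.1 jb.2|)
        ((vectorHoppingModel U u θ).tiGroundEnergyDensityAt R ρ) :=
  ⟨tiGroundEnergyDensityAt_sub_le_infCellEnergyOn_periodicLayeredViews hd hne p U hu θ hw tz hR hRR' huR hwR',
    infCellEnergyOn_periodicLayeredViews_le hd hne p U hu θ hw tz hR hRR' huR hwR'⟩

end Transport

/-! ### §4. Periodically stacked `t–t'` Hubbard crystals (bilayer, trilayer, staged cuprates) -/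

section TTPrime

/-- **The views of the periodically stacked `t–t'` Hubbard crystal on `ℤ³`** (stacking period `p + 1`, interlayer
vectors `w_b`, amplitudes `tz j b` from layers of class `j`). [cite: PavariniEtAl2001, eq. (1)] -/
def periodicLayeredHubbardTTPrimeViews (p : ℕ) (t t' U : ℝ) (w : κ → Site 3) (tz : Fin (p + 1) → κ → ℝ) :
    Cell (stackPeriods 2 p) → FermionInteraction 3 :=
  periodicLayeredViews p U ttPrimeVec (ttPrimeAmp t t') w tz

/-- **2D ROWS ⇒ WORDS FOR PERIODICALLY STACKED 3D CRYSTALS**: for `U ≥ 0`, `0 < ρ < 2`, stacking period `p + 1`,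
interlayer vectors `w_b` (`(w_b)₀ ≠ 0`, in the range box `R' ≥ 1`) with layer-class-dependent amplitudes `tz j b`:
`inf_{periodic, cell filling ρ} e ∈ [energyDensityTT' t t' U ρ − (2/(p+1))Σ_{j,b}|tz j b|, energyDensityTT' t t' U ρ]`.
[cite: ArakiMoriya2003, §11.1 Theorem 11.2] -/
theorem infCellEnergyOn_periodicLayeredHubbardTTPrime_mem_Icc (p : ℕ) (t t' : ℝ) {U : ℝ} (hU : 0 ≤ U) {ρ : ℝ}
    (hρ0 : 0 < ρ) (hρ2 : ρ < 2) {w : κ → Site 3} (hw : ∀ b, w b 0 ≠ 0) (tz : Fin (p + 1) → κ → ℝ) {R' : ℝ}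
    (hR' : 1 ≤ R') (hwR' : ∀ b, w b ∈ thicken ({0} : Finset (Site 3)) R') :
    infCellEnergyOn (periodicStatesAt (stackPeriods 2 p) ρ) (periodicLayeredHubbardTTPrimeViews p t t' U w tz) R' ∈
      Set.Icc (energyDensityTT' t t' U ρ - 2 / (p + 1) * ∑ jb : Fin (p + 1) × κ, |tz jb.1 jb.2|) (energyDensityTT' t t' U ρ) := by
  rw [← tiGroundEnergyDensityAt_hubbardTTPrime_eq_energyDensityTT' t t' hU hρ0 hρ2,
    hubbardTTPrimeFermionInteraction_eq_vectorHoppingModel]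
  exact infCellEnergyOn_periodicLayeredViews_mem_Icc two_pos (exists_isTranslationInvariant_density_eq hρ0 hρ2) p U
    ttPrimeVec_ne_zero (ttPrimeAmp t t') hw tz le_rfl hR' ttPrimeVec_mem_thicken_one hwR'

/-- **Bilayer crystals** (period `2`, vertical bonds `(1,0,0)`: intra-bilayer `t⊥` from even layers, inter-bilayer
`t⊥'` from odd layers): the window `[energyDensityTT' − (|t⊥| + |t⊥'|), energyDensityTT']` (allowance = twice the MEAN
interlayer amplitude).
[cite: ArakiMoriya2003, §11.1 Theorem 11.2] -/
theorem infCellEnergyOn_bilayerHubbardTTPrime_mem_Icc (t t' : ℝ) {U : ℝ} (hU : 0 ≤ U) {ρ : ℝ} (hρ0 : 0 < ρ)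
    (hρ2 : ρ < 2) (tperp tperp' : ℝ) :
    infCellEnergyOn (periodicStatesAt (stackPeriods 2 1) ρ)
        (periodicLayeredHubbardTTPrimeViews 1 t t' U (fun _ : Fin 1 => (unitVec (0 : Fin 3) : Site 3))
          fun j _ => ![tperp, tperp'] j) 1 ∈
      Set.Icc (energyDensityTT' t t' U ρ - (|tperp| + |tperp'|)) (energyDensityTT' t t' U ρ) := by
  have h := infCellEnergyOn_periodicLayeredHubbardTTPrime_mem_Icc 1 t t' hU hρ0 hρ2
    (w := fun _ : Fin 1 => (unitVec (0 : Fin 3) : Site 3)) (fun _ => unitVec_zero_apply_zero_ne_zero)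
    (fun j _ => ![tperp, tperp'] j) le_rfl (fun _ => unitVec_mem_thicken_one 0)
  have hsum : ∑ jb : Fin (1 + 1) × Fin 1, |![tperp, tperp'] jb.1| = |tperp| + |tperp'| := by
    rw [Fintype.sum_prod_type]
    simp [Fin.sum_univ_two]
  rw [hsum] at h
  have h2 : (2 : ℝ) / ((1 : ℕ) + 1) * (|tperp| + |tperp'|) = |tperp| + |tperp'| := by norm_num
  rw [h2] at h
  exact h

end TTPrime

end Literature.MathematicalPhysics.QuantumLattice
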